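import Literature.NumberTheory.DiophantineGeometry.FunctionFieldDerivations
import HarnessLib

/-!
# Wronskians over an algebraic function field of one variable

Topic: `Literature/NumberTheory/DiophantineGeometry`. Continuation of
`Literature.NumberTheory.DiophantineGeometry.FunctionFieldDerivations` (the derivation
`tderiv K t = d/dt` of a function field `F/K` with full constant field `K`).

For `t ∈ F` and `f₀, …, f_{n-1} ∈ F` the **Wronskian** `W_t(f₀, …, f_{n-1}) = det (dⁱf_j/dtⁱ)_{i,j<n}`
(`wronskian K t f`). We prove the standard facts recalled and used by Corvaja–Zannier (J. Algebraic
Geom. 17 (2008), §2, p. 4 of arXiv:math/0512074: "we recall some standard facts about Wronskians") and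
by Mason (LMS LNS 96, Ch. I):

* `wronskian_linComb` — `K`-linear column operations: `W_t(f · M) = W_t(f) · det M` for `M ∈ K^{n×n}`;
* `wronskian_mul` — `W_t(q g₀, …, q g_{n-1}) = qⁿ W_t(g₀, …, g_{n-1})`;
* `wronskian_eq_pow_mul_wronskian` — **change of variable** (Corvaja–Zannier (2.2)):
  `W_z(f) = (dt/dz)^{n(n-1)/2} W_t(f)`;
* `wronskian_uniformizer_mem` — if all `g_j` are integral at `P` then so is `W_{t_P}(g)` for the local
  parameter `t_P` (the derivation `d/dt_P` preserves `𝒪_P`);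
* `sum_ord_sub_le_ord_wronskian_uniformizer` — `v_P(W_{t_P}(g)) ≥ Σ_j v_P(g_j) - n(n-1)/2`
  ("`v(dˡf/dt_vˡ) ≥ v(f) - l`, looking at the individual terms in the determinant expansion",
  Corvaja–Zannier p. 5);
* `wronskian_ne_zero_of_linearIndependent` — **the Wronskian criterion** in characteristic `0`:
  if `f₀, …, f_{n-1}` are linearly independent over `K` then `W_t(f) ≠ 0` for any `t ∉ K`
  ("It is well known that `W_t = 0` if and only if the `f_i`'s are linearly dependent over `κ`.
  (Recall that here char `κ = 0`.)", Corvaja–Zannier p. 4; Bombieri–Gubler Prop. 6.3.10 for `K[X]`).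

Proofs. Column operations: `dⁱ/dtⁱ` is `K`-linear. For `wronskian_mul` and the change of variable we
expand the iterates of an operator `A = u · d/dt + w` as `Aⁱ y = Σ_{l ≤ i} c_{i,l} dˡy/dtˡ` with a lower
triangular coefficient matrix of diagonal `uⁱ` (`exists_iterate_eq_sum`), whence
`det (Aⁱ g_j) = u^{n(n-1)/2} W_t(g)` (`det_iterate_eq`); `d/dz = (dt/dz) · d/dt` is the chain rule and
`dⁱ(q y)/dtⁱ = q · (d/dt + q'/q)ⁱ y`. Integrality and the order bound: the matrix
`(t_Pⁱ g_j⁻¹ dⁱg_j/dt_Pⁱ)` has entries in `𝒪_P`. The criterion (a division-free variant of the textbook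
induction): if `W_t(f) = 0`, a non-zero row relation shows that all rows `r_i = (dⁱf_j/dtⁱ)_j`, `i ≥ 0`,
lie in the `F`-span `U` of `r_0, …, r_{m-1}` for some `m < n` (`U` is stable under `d/dt`), and a
non-zero column relation `c ⊥ r_0, …, r_{n-1}` then gives `Σ_j c_j dⁱf_j/dtⁱ = 0` for **all** `i`;
among such `c ≠ 0` take one of minimal support with some `c_{j₀} = 1`: then `c' = dc/dt` satisfies the
same relations with smaller support, so `c' = 0`, `c ∈ Kⁿ`, and `Σ c_j f_j = 0` is a `K`-linear relation.

Everything is proved; no named facts are introduced.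

## References

* P. Corvaja, U. Zannier, *Some cases of Vojta's conjecture on integral points over function fields*,
  J. Algebraic Geom. 17 (2008) 295–333, §2, (2.2). [CorvajaZannier2007]
* R. C. Mason, *Diophantine Equations over Function Fields*, LMS LNS 96 (1984), Ch. I §2. [Mason1984]
* E. Bombieri, W. Gubler, *Heights in Diophantine Geometry* (2006), Prop. 6.3.10 (the Wronskian criterion
  for polynomials). [BombieriGubler2006]
-/

noncomputable section

open scoped Classical IntermediateField
open Matrix Finset

namespace Literature.NumberTheory.DiophantineGeometry.AlgFunctionField

universe u v

variable {K : Type u} {F : Type v} [Field K] [Field F] [Algebra K F]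
variable [IsAlgFunctionField K F] [IsIntegrallyClosedIn K F]

/-! ### The Wronskian -/

variable (K) in
/-- **The Wronskian** `W_t(f₀, …, f_{n-1}) = det (dⁱf_j/dtⁱ)_{i,j<n}` of `f : Fin n → F` with respect to
`t` (rows = order of derivative, columns = the functions). [cite: CorvajaZannier2007, §2 (2.2)] -/
def wronskian (t : F) {n : ℕ} (f : Fin n → F) : F :=
  det (of fun i j : Fin n => (tderiv K t)^[i] (f j))

variable (K) in
/-- The Wronskian matrix `(dⁱf_j/dtⁱ)_{i,j}`. [cite: CorvajaZannier2007, §2 (2.2)] -/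
def wronskianMatrix (t : F) {n : ℕ} (f : Fin n → F) : Matrix (Fin n) (Fin n) F :=
  of fun i j : Fin n => (tderiv K t)^[i] (f j)

/-- Unfolding. [folklore] -/
theorem wronskian_eq_det (t : F) {n : ℕ} (f : Fin n → F) :
    wronskian K t f = det (wronskianMatrix K t f) := rfl

/-- Entries of the Wronskian matrix. [folklore] -/
@[simp]
theorem wronskianMatrix_apply (t : F) {n : ℕ} (f : Fin n → F) (i j : Fin n) :
    wronskianMatrix K t f i j = (tderiv K t)^[i] (f j) := rfl

/-- Iterated derivatives are `K`-linear: sums. [folklore] -/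
theorem iterate_tderiv_sum (t : F) (i : ℕ) {ι : Type*} (s : Finset ι) (g : ι → F) :
    (tderiv K t)^[i] (∑ l ∈ s, g l) = ∑ l ∈ s, (tderiv K t)^[i] (g l) := by
  rw [← tderivLin_pow_apply, map_sum]
  exact Finset.sum_congr rfl fun l _ ↦ tderivLin_pow_apply t i (g l)

/-- Iterated derivatives are `K`-linear: scalars. [folklore] -/
theorem iterate_tderiv_smul (t : F) (i : ℕ) (c : K) (y : F) :
    (tderiv K t)^[i] (c • y) = c • (tderiv K t)^[i] y := by
  rw [← tderivLin_pow_apply, map_smul, tderivLin_pow_apply]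

/-- Iterated derivatives are additive. [folklore] -/
theorem iterate_tderiv_add (t : F) (i : ℕ) (y z : F) :
    (tderiv K t)^[i] (y + z) = (tderiv K t)^[i] y + (tderiv K t)^[i] z := by
  rw [← tderivLin_pow_apply, map_add, tderivLin_pow_apply, tderivLin_pow_apply]

/-- Iterated derivatives kill `0`. [folklore] -/
@[simp]
theorem iterate_tderiv_zero (t : F) (i : ℕ) : (tderiv K t)^[i] (0 : F) = 0 := by
  rw [← tderivLin_pow_apply, map_zero]

/-- Iterated derivatives commute with multiplication by elements of `F` on the left of a `K`-scalar:
`dⁱ(y · c)/dtⁱ = c · dⁱy/dtⁱ` for `c ∈ K`. [folklore] -/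
theorem iterate_tderiv_mul_algebraMap (t : F) (i : ℕ) (y : F) (c : K) :
    (tderiv K t)^[i] (y * algebraMap K F c) = (tderiv K t)^[i] y * algebraMap K F c := by
  rw [mul_comm, ← Algebra.smul_def, iterate_tderiv_smul, Algebra.smul_def, mul_comm]

/-- **Column operations**: replacing `f` by the `K`-linear combinations `Σ_l M_{lj} f_l` multiplies the
Wronskian by `det M`. [cite: CorvajaZannier2007, §2 (proof of Prop. 2.1, Case (iii))] -/
theorem wronskian_linComb (t : F) {n : ℕ} (f : Fin n → F) (M : Matrix (Fin n) (Fin n) K) :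
    wronskian K t (fun j ↦ ∑ l, M l j • f l) = wronskian K t f * algebraMap K F M.det := by
  unfold wronskian
  have hmat : (of fun i j : Fin n ↦ (tderiv K t)^[i] (∑ l, M l j • f l)) =
      (of fun i l : Fin n ↦ (tderiv K t)^[i] (f l)) * M.map (algebraMap K F) := by
    refine Matrix.ext fun i j ↦ ?_
    simp only [of_apply, Matrix.mul_apply, Matrix.map_apply, iterate_tderiv_sum, iterate_tderiv_smul]
    exact Finset.sum_congr rfl fun l _ ↦ by rw [Algebra.smul_def, mul_comm]
  rw [hmat, det_mul, RingHom.map_det, RingHom.mapMatrix_apply]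

/-- Column operations for a family indexed by an arbitrary finite type `ι`, transported to `Fin n`
along `e : ι ≃ Fin n`: `W_t((f · M) ∘ e⁻¹) = W_t(f ∘ e⁻¹) · det M` for `M ∈ K^{ι×ι}`.
[cite: CorvajaZannier2007, §2 (proof of Prop. 2.1, Case (iii))] -/
theorem wronskian_linComb_equiv (t : F) {ι : Type*} [Fintype ι] [DecidableEq ι] {n : ℕ} (e : ι ≃ Fin n)
    (f : ι → F) (M : Matrix ι ι K) :
    wronskian K t ((fun y ↦ ∑ x, M x y • f x) ∘ e.symm) =
      wronskian K t (f ∘ e.symm) * algebraMap K F M.det := by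
  have hfun : (fun y ↦ ∑ x, M x y • f x) ∘ e.symm =
      fun j ↦ ∑ l, (M.submatrix e.symm e.symm) l j • (f ∘ e.symm) l := by
    funext j
    simp only [Function.comp_apply, Matrix.submatrix_apply]
    exact (Equiv.sum_comp e.symm (fun x ↦ M x (e.symm j) • f x)).symm
  rw [hfun, wronskian_linComb, Matrix.det_submatrix_equiv_self]

/-! ### Iterates of `u · d/dt + w` -/

section expansion

variable (K) in
/-- The coefficients `c_{i,l}` of the expansion `Aⁱ y = Σ_{l ≤ i} c_{i,l} dˡy/dtˡ` of the iterates of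
`A = u · d/dt + w`, defined by the recursion
`c_{i+1,l} = u · dc_{i,l}/dt + w · c_{i,l} + u · c_{i,l-1}`, `c_{0,l} = δ_{0,l}`. [folklore] -/
def expCoeff (t u w : F) : ℕ → ℕ → F
  | 0, l => if l = 0 then 1 else 0
  | i + 1, l => u * tderiv K t (expCoeff t u w i l) + w * expCoeff t u w i l +
      u * (if l = 0 then 0 else expCoeff t u w i (l - 1))

/-- `c_{i,l} = 0` for `l > i` (lower triangularity). [folklore] -/
theorem expCoeff_eq_zero_of_lt (t u w : F) {i l : ℕ} (h : i < l) : expCoeff K t u w i l = 0 := by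
  induction i generalizing l with
  | zero => simp [expCoeff, Nat.pos_iff_ne_zero.1 h]
  | succ i ih =>
    rw [expCoeff, ih (by omega), tderiv_zero, mul_zero, mul_zero, zero_add, zero_add,
      if_neg (by omega), ih (by omega), mul_zero]

/-- `c_{i,i} = uⁱ` (the diagonal). [folklore] -/
theorem expCoeff_self (t u w : F) (i : ℕ) : expCoeff K t u w i i = u ^ i := by
  induction i with
  | zero => simp [expCoeff]
  | succ i ih =>
    rw [expCoeff, expCoeff_eq_zero_of_lt t u w (Nat.lt_succ_self i), tderiv_zero, mul_zero,
      mul_zero, zero_add, zero_add, if_neg (Nat.succ_ne_zero i), Nat.succ_sub_one, ih, pow_succ,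
      mul_comm]

/-- **Expansion of the iterates of `A = u · d/dt + w`**: `Aⁱ y = Σ_{l ≤ i} c_{i,l} · dˡy/dtˡ`. [folklore] -/
theorem iterate_eq_sum_expCoeff (t u w : F) (i : ℕ) (y : F) :
    (fun x ↦ u * tderiv K t x + w * x)^[i] y =
      ∑ l ∈ range (i + 1), expCoeff K t u w i l * (tderiv K t)^[l] y := by
  induction i with
  | zero => simp [expCoeff]
  | succ i ih =>
    rw [Function.iterate_succ_apply', ih]
    -- differentiate the sum
    have hD : tderiv K t (∑ l ∈ range (i + 1), expCoeff K t u w i l * (tderiv K t)^[l] y) =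
        ∑ l ∈ range (i + 1), (tderiv K t (expCoeff K t u w i l) * (tderiv K t)^[l] y +
          expCoeff K t u w i l * (tderiv K t)^[l + 1] y) := by
      rw [show tderiv K t (∑ l ∈ range (i + 1), expCoeff K t u w i l * (tderiv K t)^[l] y) =
          (tderiv K t)^[1] (∑ l ∈ range (i + 1), expCoeff K t u w i l * (tderiv K t)^[l] y) from rfl,
        iterate_tderiv_sum]
      refine Finset.sum_congr rfl fun l _ ↦ ?_
      rw [Function.iterate_one, tderiv_mul, Function.iterate_succ_apply']
      ring
    -- the target sum, split according to the recursion
    have hR : ∑ l ∈ range (i + 1 + 1), expCoeff K t u w (i + 1) l * (tderiv K t)^[l] y =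
        ∑ l ∈ range (i + 1), ((u * tderiv K t (expCoeff K t u w i l) + w * expCoeff K t u w i l) *
            (tderiv K t)^[l] y + u * expCoeff K t u w i l * (tderiv K t)^[l + 1] y) := by
      have h1 : ∀ l, expCoeff K t u w (i + 1) l =
          (u * tderiv K t (expCoeff K t u w i l) + w * expCoeff K t u w i l) +
            u * (if l = 0 then 0 else expCoeff K t u w i (l - 1)) := fun l ↦ by
        rw [expCoeff]
      have h2 : ∑ l ∈ range (i + 1 + 1), expCoeff K t u w (i + 1) l * (tderiv K t)^[l] y =
          ∑ l ∈ range (i + 1 + 1), (u * tderiv K t (expCoeff K t u w i l) + w * expCoeff K t u w i l) *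
              (tderiv K t)^[l] y +
            ∑ l ∈ range (i + 1 + 1), u * (if l = 0 then 0 else expCoeff K t u w i (l - 1)) *
              (tderiv K t)^[l] y := by
        rw [← Finset.sum_add_distrib]
        exact Finset.sum_congr rfl fun l _ ↦ by rw [h1 l, add_mul]
      rw [h2, Finset.sum_range_succ (fun l ↦ (u * tderiv K t (expCoeff K t u w i l) +
          w * expCoeff K t u w i l) * (tderiv K t)^[l] y) (i + 1),
        expCoeff_eq_zero_of_lt t u w (Nat.lt_succ_self i), tderiv_zero, mul_zero, mul_zero, add_zero,
        zero_mul, add_zero,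
        Finset.sum_range_succ' (fun l ↦ u * (if l = 0 then 0 else expCoeff K t u w i (l - 1)) *
          (tderiv K t)^[l] y) (i + 1),
        if_pos rfl, mul_zero, zero_mul, add_zero, ← Finset.sum_add_distrib]
      refine Finset.sum_congr rfl fun l _ ↦ ?_
      rw [if_neg (Nat.succ_ne_zero l), Nat.succ_sub_one]
    rw [hR, hD, Finset.mul_sum, Finset.mul_sum, ← Finset.sum_add_distrib]
    exact Finset.sum_congr rfl fun l _ ↦ by ring

/-- **Determinant form of the expansion**: for `A = u · d/dt + w` and `g : Fin n → F`,
`det (Aⁱ g_j)_{i,j<n} = u^{n(n-1)/2} · W_t(g)`. [cite: CorvajaZannier2007, §2 (2.2)] -/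
theorem det_iterate_eq (t u w : F) {n : ℕ} (g : Fin n → F) :
    det (of fun i j : Fin n ↦ (fun x ↦ u * tderiv K t x + w * x)^[i] (g j)) =
      u ^ (n * (n - 1) / 2) * wronskian K t g := by
  set C : Matrix (Fin n) (Fin n) F := of fun i l ↦ expCoeff K t u w i l with hC
  have hmat : (of fun i j : Fin n ↦ (fun x ↦ u * tderiv K t x + w * x)^[i] (g j)) =
      C * wronskianMatrix K t g := by
    refine Matrix.ext fun i j ↦ ?_
    rw [Matrix.mul_apply, of_apply, iterate_eq_sum_expCoeff]
    simp only [hC, of_apply, wronskianMatrix_apply]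
    rw [Fin.sum_univ_eq_sum_range (fun l ↦ expCoeff K t u w i l * (tderiv K t)^[l] (g j)) n]
    refine Finset.sum_subset (Finset.range_subset_range.2 (by omega)) fun l hl hl' ↦ ?_
    rw [Finset.mem_range] at hl hl'
    rw [expCoeff_eq_zero_of_lt t u w (by omega), zero_mul]
  have hCtri : C.BlockTriangular OrderDual.toDual := fun i l hil ↦ by
    rw [hC, of_apply]
    exact expCoeff_eq_zero_of_lt t u w (by simpa using hil)
  have hdetC : det C = u ^ (n * (n - 1) / 2) := by
    rw [det_of_lowerTriangular C hCtri]
    simp only [hC, of_apply, expCoeff_self]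
    rw [Fin.prod_univ_eq_prod_range (fun i ↦ u ^ i) n, prod_pow_eq_pow_sum, sum_range_id]
  rw [hmat, det_mul, hdetC, wronskian_eq_det]

end expansion

/-! ### Scaling and change of variable -/

/-- `dⁱ(q y)/dtⁱ = q · (d/dt + q'/q)ⁱ y` for `q ≠ 0`. [folklore] -/
theorem iterate_tderiv_mul_eq (t : F) {q : F} (hq : q ≠ 0) (i : ℕ) (y : F) :
    (tderiv K t)^[i] (q * y) =
      q * (fun x ↦ 1 * tderiv K t x + (tderiv K t q * q⁻¹) * x)^[i] y := by
  induction i with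
  | zero => simp
  | succ i ih =>
    rw [Function.iterate_succ_apply', ih, tderiv_mul, Function.iterate_succ_apply']
    field_simp

/-- **Scaling**: `W_t(q g₀, …, q g_{n-1}) = qⁿ · W_t(g)`. [cite: CorvajaZannier2007, §2 (proof of Prop. 2.1)] -/
theorem wronskian_mul (t : F) {q : F} (hq : q ≠ 0) {n : ℕ} (g : Fin n → F) :
    wronskian K t (fun j ↦ q * g j) = q ^ n * wronskian K t g := by
  have hmat : (of fun i j : Fin n ↦ (tderiv K t)^[i] (q * g j)) =
      q • of fun i j : Fin n ↦ (fun x ↦ 1 * tderiv K t x + (tderiv K t q * q⁻¹) * x)^[i] (g j) := by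
    refine Matrix.ext fun i j ↦ ?_
    rw [of_apply, Matrix.smul_apply, of_apply, iterate_tderiv_mul_eq t hq, smul_eq_mul]
  rw [wronskian, hmat, det_smul, Fintype.card_fin, det_iterate_eq, one_pow, one_mul]

/-- **Change of variable** (Corvaja–Zannier (2.2)): `W_z(f) = (dt/dz)^{n(n-1)/2} · W_t(f)` for `z, t`
with `dz, dt ≠ 0` (chain rule `d/dz = (dt/dz) · d/dt`). [cite: CorvajaZannier2007, §2 (2.2)] -/
theorem wronskian_eq_pow_mul_wronskian {z t : F} (hz : dOf K z ≠ 0) (ht : dOf K t ≠ 0) {n : ℕ}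
    (f : Fin n → F) :
    wronskian K z f = tderiv K z t ^ (n * (n - 1) / 2) * wronskian K t f := by
  have hD : tderiv K z = fun x ↦ tderiv K z t * tderiv K t x + 0 * x := by
    funext x
    rw [zero_mul, add_zero, mul_comm]
    exact tderiv_eq_tderiv_mul_tderiv hz ht x
  conv_lhs => rw [wronskian, hD]
  exact det_iterate_eq t _ _ f

/-! ### Integrality and orders at a place (local parameter `t_P`) -/

section place

variable [CharZero K]

/-- **Integrality**: if every `g_j` is integral at `P`, so is `W_{t_P}(g)` for the local parameter `t_P`
("every element of the local Wronskian matrix is `v`-integral, so the same holds for the determinant",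
Corvaja–Zannier, Case (ii)). [cite: CorvajaZannier2007, §2 (proof of Prop. 2.1, Case (ii))] -/
theorem wronskian_uniformizer_mem (hrat : ∀ P : PlaceOver K F, P.IsRational) (P : PlaceOver K F) {n : ℕ}
    {g : Fin n → F} (hg : ∀ j, g j ∈ P.toValuationSubring) :
    wronskian K (P.uniformizer : F) g ∈ P.toValuationSubring := by
  let M' : Matrix (Fin n) (Fin n) P.toValuationSubring :=
    of fun i j ↦ ⟨(tderiv K (P.uniformizer : F))^[i] (g j), iterate_tderiv_uniformizer_mem hrat P (hg j) i⟩
  have hmap : (P.toValuationSubring.subtype).mapMatrix M' = wronskianMatrix K (P.uniformizer : F) g :=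
    Matrix.ext fun i j ↦ rfl
  rw [wronskian_eq_det, ← hmap, ← RingHom.map_det]
  exact (det M').2

omit [IsAlgFunctionField K F] [IsIntegrallyClosedIn K F] [CharZero K] in
/-- Orders of finite products. [folklore] -/
theorem PlaceOver.ord_prod (P : PlaceOver K F) {ι : Type*} (s : Finset ι) (f : ι → F)
    (hf : ∀ i ∈ s, f i ≠ 0) : P.ord (∏ i ∈ s, f i) = ∑ i ∈ s, P.ord (f i) := by
  induction s using Finset.induction_on with
  | empty => simp [PlaceOver.ord_one]
  | insert a s ha ih =>
    rw [Finset.prod_insert ha, Finset.sum_insert ha,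
      P.ord_mul_eq (hf a (Finset.mem_insert_self a s))
        (Finset.prod_ne_zero_iff.2 fun i hi ↦ hf i (Finset.mem_insert_of_mem hi)),
      ih fun i hi ↦ hf i (Finset.mem_insert_of_mem hi)]

/-- **The order of a local Wronskian**: `v_P(W_{t_P}(g)) ≥ Σ_j v_P(g_j) - n(n-1)/2` for non-zero `g_j`
and `W_{t_P}(g) ≠ 0` — since `v(dˡg/dt_Pˡ) ≥ v(g) - l`, "looking at the individual terms in the
determinant expansion" (Corvaja–Zannier, Cases (iii), (iv)); here: the matrix
`(t_Pⁱ g_j⁻¹ dⁱg_j/dt_Pⁱ)` is integral at `P`. [cite: CorvajaZannier2007, §2 (proof of Prop. 2.1, Cases (iii)–(iv))] -/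
theorem sum_ord_sub_le_ord_wronskian_uniformizer (hrat : ∀ P : PlaceOver K F, P.IsRational)
    (P : PlaceOver K F) {n : ℕ} {g : Fin n → F} (hg : ∀ j, g j ≠ 0)
    (hW : wronskian K (P.uniformizer : F) g ≠ 0) :
    ∑ j, P.ord (g j) - (n * (n - 1) / 2 : ℕ) ≤ P.ord (wronskian K (P.uniformizer : F) g) := by
  set π : F := (P.uniformizer : F) with hπ
  have hπ0 : π ≠ 0 := P.coe_uniformizer_ne_zero
  set M := wronskianMatrix K π g with hM
  set N₁ : Matrix (Fin n) (Fin n) F := of fun i j ↦ (g j)⁻¹ * M i j with hN₁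
  set N : Matrix (Fin n) (Fin n) F := of fun i j ↦ π ^ (i : ℕ) * N₁ i j with hN
  have hdet₁ : det N₁ = (∏ j, (g j)⁻¹) * det M := det_mul_row _ _
  have hdet : det N = (∏ i : Fin n, π ^ (i : ℕ)) * det N₁ := det_mul_column _ _
  -- `N` is integral at `P`
  have hNmem : ∀ i j, N i j ∈ P.toValuationSubring := by
    intro i j
    have hNij : N i j = π ^ (i : ℕ) * ((g j)⁻¹ * (tderiv K π)^[i] (g j)) := rfl
    rw [hNij]
    by_cases h0 : (tderiv K π)^[i] (g j) = 0
    · rw [h0, mul_zero, mul_zero]; exact zero_mem _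
    have hne : π ^ (i : ℕ) * ((g j)⁻¹ * (tderiv K π)^[i] (g j)) ≠ 0 :=
      mul_ne_zero (pow_ne_zero _ hπ0) (mul_ne_zero (inv_ne_zero (hg j)) h0)
    refine (P.mem_toValuationSubring_iff_ord_nonneg hne).2 ?_
    rw [P.ord_mul_eq (pow_ne_zero _ hπ0) (mul_ne_zero (inv_ne_zero (hg j)) h0),
      P.ord_mul_eq (inv_ne_zero (hg j)) h0, P.ord_pow hπ0, P.ord_uniformizer_eq_one, P.ord_inv (hg j)]
    have := ord_sub_le_ord_iterate_tderiv_uniformizer hrat P (g j) i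
    rw [← hπ] at this
    linarith
  have hdetNmem : det N ∈ P.toValuationSubring := by
    let N' : Matrix (Fin n) (Fin n) P.toValuationSubring := of fun i j ↦ ⟨N i j, hNmem i j⟩
    have hmap : (P.toValuationSubring.subtype).mapMatrix N' = N := Matrix.ext fun i j ↦ rfl
    rw [← hmap, ← RingHom.map_det]
    exact (det N').2
  have hprodπ : (∏ i : Fin n, π ^ (i : ℕ)) = π ^ (n * (n - 1) / 2) := by
    rw [Fin.prod_univ_eq_prod_range (fun i ↦ π ^ i) n, prod_pow_eq_pow_sum, sum_range_id]
  have hprodg : (∏ j, (g j)⁻¹) ≠ 0 := Finset.prod_ne_zero_iff.2 fun j _ ↦ inv_ne_zero (hg j)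
  have hdetM : det M = wronskian K π g := rfl
  have hdetN0 : det N ≠ 0 := by
    rw [hdet, hdet₁, hprodπ, hdetM]
    exact mul_ne_zero (pow_ne_zero _ hπ0) (mul_ne_zero hprodg hW)
  have h0 := P.ord_nonneg_of_mem hdetNmem
  rw [hdet, hdet₁, hprodπ, hdetM, P.ord_mul_eq (pow_ne_zero _ hπ0) (mul_ne_zero hprodg hW),
    P.ord_mul_eq hprodg hW, P.ord_pow hπ0, P.ord_uniformizer_eq_one,
    P.ord_prod _ _ (fun j _ ↦ inv_ne_zero (hg j))] at h0
  simp only [P.ord_inv (hg _), Finset.sum_neg_distrib, mul_one] at h0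
  linarith

end place

/-! ### The Wronskian criterion for linear independence (characteristic `0`) -/

section criterion

variable [CharZero K]

/-- **The Wronskian criterion.** In characteristic `0` (all places rational, `t ∉ K`): if
`f₀, …, f_{n-1} ∈ F` are linearly independent over the constant field `K`, then `W_t(f) ≠ 0`.
[cite: CorvajaZannier2007, §2 ("`W_t = 0` iff the `f_i` are linearly dependent over `κ`")] -/
theorem wronskian_ne_zero_of_linearIndependent (hrat : ∀ P : PlaceOver K F, P.IsRational) {t : F}
    (ht : t ∉ Set.range (algebraMap K F)) {n : ℕ} {f : Fin n → F} (hf : LinearIndependent K f) :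
    wronskian K t f ≠ 0 := by
  intro hW
  -- the rows `r i = (Dⁱ f_j)_j`, for all `i ≥ 0`
  set r : ℕ → Fin n → F := fun i j ↦ (tderiv K t)^[i] (f j) with hr
  have hr_succ : ∀ i, r (i + 1) = fun j ↦ tderiv K t (r i j) := fun i ↦ by
    funext j; simp only [hr, Function.iterate_succ_apply']
  have hD1 : ∀ x : F, tderiv K t x = (tderiv K t)^[1] x := fun x ↦ rfl
  have hM : wronskianMatrix K t f = of fun i j : Fin n ↦ r i j := rfl
  have hW' : det (wronskianMatrix K t f) = 0 := hW
  -- Step 1: a non-zero row relation, and the `d/dt`-stable span `U` of the first `m` rows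
  obtain ⟨v, hv0, hv⟩ := Matrix.exists_vecMul_eq_zero_iff.2 hW'
  have hvrel : ∑ i : Fin n, v i • r i = 0 := by
    funext j
    have := congrFun hv j
    simp only [vecMul, dotProduct, hM, of_apply, Pi.zero_apply] at this
    simpa [Finset.sum_apply, Pi.smul_apply, smul_eq_mul] using this
  set s : Finset (Fin n) := Finset.univ.filter fun i ↦ v i ≠ 0 with hs
  have hsne : s.Nonempty := by
    by_contra h
    rw [Finset.not_nonempty_iff_eq_empty] at h
    exact hv0 (funext fun i ↦ by
      by_contra hi
      have : i ∈ s := Finset.mem_filter.2 ⟨Finset.mem_univ _, hi⟩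
      rw [h] at this; exact Finset.notMem_empty _ this)
  set m : Fin n := s.max' hsne with hm
  have hvm : v m ≠ 0 := (Finset.mem_filter.1 (s.max'_mem hsne)).2
  have hvgt : ∀ i : Fin n, m < i → v i = 0 := fun i hi ↦ by
    by_contra h
    exact absurd (s.le_max' i (Finset.mem_filter.2 ⟨Finset.mem_univ _, h⟩)) (not_le.2 (hm ▸ hi))
  set U : Submodule F (Fin n → F) := Submodule.span F (Set.range fun l : Fin m ↦ r l) with hU
  have hrl : ∀ l : ℕ, l < m → r l ∈ U := fun l hl ↦
    Submodule.subset_span ⟨⟨l, hl⟩, rfl⟩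
  -- `r m ∈ U` from the row relation
  have hrm : r m ∈ U := by
    have hsum : ∑ i : Fin n, v i • r i = v m • r m + ∑ i ∈ Finset.univ.erase m, v i • r i := by
      rw [← Finset.add_sum_erase _ _ (Finset.mem_univ m)]
    have hrest : ∑ i ∈ Finset.univ.erase m, v i • r i ∈ U := by
      refine Submodule.sum_mem _ fun i hi ↦ ?_
      rcases lt_trichotomy i m with h | h | h
      · exact Submodule.smul_mem _ _ (hrl i (by exact_mod_cast h))
      · exact absurd h (Finset.ne_of_mem_erase hi)
      · rw [hvgt i h, zero_smul]; exact zero_mem _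
    have h1 : v m • r m = -∑ i ∈ Finset.univ.erase m, v i • r i := by
      rw [eq_neg_iff_add_eq_zero, ← hsum, hvrel]
    have h2 : r m = (v m)⁻¹ • -∑ i ∈ Finset.univ.erase m, v i • r i := by
      rw [← h1, smul_smul, inv_mul_cancel₀ hvm, one_smul]
    rw [h2]
    exact Submodule.smul_mem _ _ (neg_mem hrest)
  -- `U` is stable under `d/dt` applied coordinatewise
  have hUstable : ∀ x ∈ U, (fun j ↦ tderiv K t (x j)) ∈ U := by
    intro x hx
    obtain ⟨a, rfl⟩ := (Submodule.mem_span_range_iff_exists_fun F).1 hx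
    have hcalc : (fun j ↦ tderiv K t ((∑ l : Fin m, a l • r l) j)) =
        ∑ l : Fin m, tderiv K t (a l) • r l + ∑ l : Fin m, a l • r ((l : ℕ) + 1) := by
      funext j
      simp only [Finset.sum_apply, Pi.add_apply, Pi.smul_apply, smul_eq_mul]
      rw [hD1, iterate_tderiv_sum, ← Finset.sum_add_distrib]
      refine Finset.sum_congr rfl fun l _ ↦ ?_
      rw [Function.iterate_one, tderiv_mul, hr_succ]
      ring
    rw [hcalc]
    refine add_mem (Submodule.sum_mem _ fun l _ ↦ Submodule.smul_mem _ _ (hrl l l.2))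
      (Submodule.sum_mem _ fun l _ ↦ Submodule.smul_mem _ _ ?_)
    rcases (Nat.succ_le_of_lt l.2).eq_or_lt with h | h
    · have h' : (l : ℕ) + 1 = m := h
      rw [h']; exact hrm
    · exact hrl _ h
  have hrall : ∀ i, r i ∈ U := by
    intro i
    induction i with
    | zero =>
      rcases Nat.eq_zero_or_pos m with h0 | hpos
      · have : r m ∈ U := hrm
        rwa [h0] at this
      · exact hrl 0 hpos
    | succ i ih => rw [hr_succ]; exact hUstable _ ih
  -- a non-zero column relation `c ⊥ r 0, …, r (n-1)`, hence `c ⊥ U ∋ r i` for all `i`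
  obtain ⟨c, hc0, hc⟩ := Matrix.exists_mulVec_eq_zero_iff.2 hW'
  have hcrel : ∀ i : Fin n, ∑ j, c j * r i j = 0 := fun i ↦ by
    have := congrFun hc i
    simp only [mulVec, dotProduct, hM, of_apply, Pi.zero_apply] at this
    simpa [mul_comm] using this
  let φ : (Fin n → F) →ₗ[F] F :=
    { toFun := fun x ↦ ∑ j, c j * x j
      map_add' := fun x y ↦ by simp [mul_add, Finset.sum_add_distrib]
      map_smul' := fun a x ↦ by simp [Finset.mul_sum, mul_left_comm] }
  have hUker : U ≤ LinearMap.ker φ := by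
    rw [hU, Submodule.span_le]
    rintro _ ⟨l, rfl⟩
    exact hcrel ⟨l, lt_trans l.2 m.2⟩
  have hall : ∀ i : ℕ, ∑ j, c j * (tderiv K t)^[i] (f j) = 0 := fun i ↦ hUker (hrall i)
  -- Step 2: minimal support
  have hex : ∃ k : ℕ, ∃ c : Fin n → F, c ≠ 0 ∧ (Finset.univ.filter fun j ↦ c j ≠ 0).card = k ∧
      ∀ i : ℕ, ∑ j, c j * (tderiv K t)^[i] (f j) = 0 := ⟨_, c, hc0, rfl, hall⟩
  obtain ⟨c₁, hc₁0, hcard, hc₁⟩ := Nat.find_spec hex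
  have hmin : ∀ c' : Fin n → F, c' ≠ 0 → (∀ i : ℕ, ∑ j, c' j * (tderiv K t)^[i] (f j) = 0) →
      (Finset.univ.filter fun j ↦ c₁ j ≠ 0).card ≤ (Finset.univ.filter fun j ↦ c' j ≠ 0).card := by
    intro c' hc'0 hc'
    rw [hcard]
    by_contra hlt
    exact Nat.find_min hex (not_le.1 hlt) ⟨c', hc'0, rfl, hc'⟩
  obtain ⟨j₀, hj₀⟩ : ∃ j₀, c₁ j₀ ≠ 0 := by
    by_contra h
    push Not at h
    exact hc₁0 (funext h)
  -- normalise: `c₂ j₀ = 1`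
  set c₂ : Fin n → F := fun j ↦ c₁ j * (c₁ j₀)⁻¹ with hc₂
  have hc₂j₀ : c₂ j₀ = 1 := mul_inv_cancel₀ hj₀
  have hc₂rel : ∀ i : ℕ, ∑ j, c₂ j * (tderiv K t)^[i] (f j) = 0 := fun i ↦ by
    have := congrArg (· * (c₁ j₀)⁻¹) (hc₁ i)
    simpa [hc₂, Finset.sum_mul, mul_right_comm] using this
  have hsupp₂ : (Finset.univ.filter fun j ↦ c₂ j ≠ 0) = Finset.univ.filter fun j ↦ c₁ j ≠ 0 := by
    ext j; simp [hc₂, hj₀]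
  -- differentiate: `c₃ = dc₂/dt` satisfies the relations and has smaller support
  set c₃ : Fin n → F := fun j ↦ tderiv K t (c₂ j) with hc₃
  have hc₃rel : ∀ i : ℕ, ∑ j, c₃ j * (tderiv K t)^[i] (f j) = 0 := fun i ↦ by
    have h1 : tderiv K t (∑ j, c₂ j * (tderiv K t)^[i] (f j)) = 0 := by rw [hc₂rel i, tderiv_zero]
    rw [hD1, iterate_tderiv_sum] at h1
    simp only [Function.iterate_one] at h1
    have h2 : ∑ j, tderiv K t (c₂ j * (tderiv K t)^[i] (f j)) =
        ∑ j, (c₃ j * (tderiv K t)^[i] (f j) + c₂ j * (tderiv K t)^[i + 1] (f j)) := by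
      refine Finset.sum_congr rfl fun j _ ↦ ?_
      rw [tderiv_mul, Function.iterate_succ_apply']
      ring
    rw [h2, Finset.sum_add_distrib, hc₂rel (i + 1), add_zero] at h1
    exact h1
  have hsupp₃ : (Finset.univ.filter fun j ↦ c₃ j ≠ 0) ⊂ Finset.univ.filter fun j ↦ c₂ j ≠ 0 := by
    rw [Finset.ssubset_iff_of_subset]
    · refine ⟨j₀, Finset.mem_filter.2 ⟨Finset.mem_univ _, by rw [hc₂j₀]; exact one_ne_zero⟩, ?_⟩
      simp [hc₃, hc₂j₀]
    · intro j hj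
      rw [Finset.mem_filter] at hj ⊢
      refine ⟨Finset.mem_univ _, fun h ↦ hj.2 ?_⟩
      simp only [hc₃, h, tderiv_zero]
  have hc₃0 : c₃ = 0 := by
    by_contra h
    have := hmin c₃ h hc₃rel
    rw [← hsupp₂] at this
    exact absurd (Finset.card_lt_card hsupp₃) (not_lt.2 this)
  -- so `c₂ ∈ Kⁿ`, and the relation `i = 0` is a `K`-linear relation among the `f_j`
  have hconst : ∀ j, ∃ k : K, algebraMap K F k = c₂ j := fun j ↦ by
    have : tderiv K t (c₂ j) = 0 := congrFun hc₃0 j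
    exact (tderiv_eq_zero_iff hrat ht (c₂ j)).1 this
  choose k hk using hconst
  have hrel0 : ∑ j, k j • f j = 0 := by
    have := hc₂rel 0
    simp only [Function.iterate_zero, id_eq] at this
    simpa [Algebra.smul_def, hk] using this
  have := Fintype.linearIndependent_iff.1 hf k hrel0 j₀
  apply one_ne_zero (α := F)
  rw [← hc₂j₀, ← hk j₀, this, map_zero]

end criterion

end Literature.NumberTheory.DiophantineGeometry.AlgFunctionField
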